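import Literature.Barriers.BirchSwinnertonDyer.RankNotSumOfLocalInvariantsF3NormDescentK13Proofs
import Literature.NumberTheory.NumberFields.CyclicCubicField103Descent
import HarnessLib

/-!
# Barrier (BirchSwinnertonDyer), rank mod `3`: the conductor-`103` descent, and what remains

Continuation of `RankNotSumOfLocalInvariantsF3NormDescentK13Proofs.lean` towards the named fact
`Literature.Barriers.BirchSwinnertonDyer.DokchitserDokchitser2011_rank_480a1_F3` (`rk E(F₃) = 1` for
`E = 480a1` over the degree-`9` field `F₃ ⊂ ℚ(ζ₁₃, ζ₁₀₃)` of T. Dokchitser–V. Dokchitser, *A note on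
the Mordell–Weil rank modulo `n`*, J. Number Theory 131 (2011), proof of Thm. 2). Here the SECOND of
the four cubic norm descents is discharged, over every cubic extension of `ℚ` containing a root of
`f₁₀₃ = X³ + X² - 34X - 61` (the cyclic cubic field of conductor `103`), by the explicit `2`-descent of
`Literature/NumberTheory/NumberFields/CyclicCubicField103Descent.lean`
(`Literature.NumberTheory.NumberFields.CyclicCubic103.normDescent_of_root`):

* `curve480a1.normDescent_of_root103`, `curve480a1.mordellWeilRank_baseChange_eq_one_of_root103`
  (and `…_le_one_of_root103`, the hypothesis `h103` of
  `DokchitserDokchitser2011.descent_480a1_F3_cubic_of_cubics`);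
* `DokchitserDokchitser2011_rank_480a1_F3_of_normDescent_1339`: CONSEQUENTLY the named fact follows
  from the norm-`1` descent statements for the two cyclic cubic fields of conductor `1339`
  (`f' = X³ + X² - 446X + 248`, `f'' = X³ + X² - 446X - 3769`), which remain as hypotheses (no named
  fact is introduced).

## References

* T. Dokchitser, V. Dokchitser, *A note on the Mordell–Weil rank modulo `n`*, J. Number Theory 131
  (2011) 1833–1839, arXiv:0910.4588: proof of Thm. 2. [DokchitserDokchitser2011RankModN]
* J. H. Silverman, *The Arithmetic of Elliptic Curves*, 2nd ed., GTM 106 (2009): Prop. X.1.4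
  (complete `2`-descent). [SilvermanAEC2009]
-/

noncomputable section

open scoped NumberField

open NumberField WeierstrassCurve IntermediateField

namespace Literature.Barriers.BirchSwinnertonDyer

open Literature.NumberTheory.NumberFields

namespace curve480a1

/-- **The norm-`1` `2`-descent of `480a1` over the cubic field of conductor `103`, in every
presentation**: for a cubic extension `K/ℚ` containing a root `θ` of `f₁₀₃ = X³ + X² - 34X - 61` and
a point `(x, y) ∈ E(K)`, `x ≠ 0, -2, 3`, with `N_{K/ℚ}(x)`, `N_{K/ℚ}(x + 2)` rational squares, `x` and
`x + 2` are squares in `K` (`CyclicCubic103.normDescent_of_root`).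
[cite: DokchitserDokchitser2011RankModN, proof of Thm. 2] -/
theorem normDescent_of_root103 (K : Type) [Field K] [Algebra ℚ K] (h3 : Module.finrank ℚ K = 3)
    {θ : K} (hθ : θ ^ 3 + θ ^ 2 - 34 * θ - 61 = 0) :
    ∀ x y : K, (curve480a1.baseChange K).toAffine.Nonsingular x y →
      x ≠ 0 → x ≠ -2 → x ≠ 3 → IsSquare (Algebra.norm ℚ x) → IsSquare (Algebra.norm ℚ (x + 2)) →
      IsSquare x ∧ IsSquare (x + 2) := fun _ _ hxy h0 h2 h3' hN hN2 =>
  have hpt := eq_and_ne_of_nonsingular K hxy h0 h2 h3'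
  CyclicCubic103.normDescent_of_root h3 hθ hpt.1 hpt.2 hN hN2

/-- **`rk E(K) = 1` for `E = 480a1` over every Galois cubic number field containing a root of
`f₁₀₃`** (the conductor-`103` case of "2-descent […] over all minimal non-trivial subfields of
`F₃`"). [cite: DokchitserDokchitser2011RankModN, proof of Thm. 2] -/
theorem mordellWeilRank_baseChange_eq_one_of_root103 (K : Type) [Field K] [NumberField K]
    [Algebra ℚ K] [IsGalois ℚ K] (h3 : Module.finrank ℚ K = 3) {θ : K}
    (hθ : θ ^ 3 + θ ^ 2 - 34 * θ - 61 = 0) : (curve480a1.baseChange K).mordellWeilRank = 1 :=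
  mordellWeilRank_baseChange_eq_one_of_odd_of_normDescent K (by rw [h3]; exact ⟨1, rfl⟩)
    (normDescent_of_root103 K h3 hθ)

/-- The same as a rank BOUND, in the shape of hypothesis `h103` of
`DokchitserDokchitser2011.descent_480a1_F3_cubic_of_cubics`. [cite: DokchitserDokchitser2011RankModN, proof of Thm. 2] -/
theorem mordellWeilRank_baseChange_le_one_of_root103 :
    ∀ (K : Type) [Field K] [NumberField K] [IsGalois ℚ K],
      Module.finrank ℚ K = 3 → ∀ θ : K, θ ^ 3 + θ ^ 2 - 34 * θ - 61 = 0 →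
        (curve480a1.baseChange K).mordellWeilRank ≤ 1 :=
  fun K _ _ _ h3 _ hθ => (mordellWeilRank_baseChange_eq_one_of_root103 K h3 hθ).le

end curve480a1

open DokchitserDokchitser2011 in
/-- **What remains of the `n = 3` fact after the conductor-`13` and conductor-`103` descents.**
The named fact `DokchitserDokchitser2011_rank_480a1_F3` follows from the norm-`1` `2`-descent
statements of `480a1` over the cubic extensions of `ℚ` generated by a root of
`f' = X³ + X² - 446X + 248` and of `f'' = X³ + X² - 446X - 3769` (the two cyclic cubic fields of
conductor `1339 = 13 · 103`). [cite: DokchitserDokchitser2011RankModN, proof of Thm. 2] -/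
theorem DokchitserDokchitser2011_rank_480a1_F3_of_normDescent_1339
    (h1339a : ∀ (K : Type) [Field K] [Algebra ℚ K], Module.finrank ℚ K = 3 →
      ∀ θ : K, θ ^ 3 + θ ^ 2 - 446 * θ + 248 = 0 → ∀ x y : K, y ^ 2 = x * (x + 2) * (x - 3) →
        y ≠ 0 → IsSquare (Algebra.norm ℚ x) → IsSquare (Algebra.norm ℚ (x + 2)) →
        IsSquare x ∧ IsSquare (x + 2))
    (h1339b : ∀ (K : Type) [Field K] [Algebra ℚ K], Module.finrank ℚ K = 3 →
      ∀ θ : K, θ ^ 3 + θ ^ 2 - 446 * θ - 3769 = 0 → ∀ x y : K, y ^ 2 = x * (x + 2) * (x - 3) →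
        y ≠ 0 → IsSquare (Algebra.norm ℚ x) → IsSquare (Algebra.norm ℚ (x + 2)) →
        IsSquare x ∧ IsSquare (x + 2)) :
    DokchitserDokchitser2011_rank_480a1_F3 :=
  DokchitserDokchitser2011_rank_480a1_F3_of_normDescent_103_1339
    (fun _ _ _ h3 _ hθ _ _ hE hy hN hN2 => CyclicCubic103.normDescent_of_root h3 hθ hE hy hN hN2)
    h1339a h1339b

end Literature.Barriers.BirchSwinnertonDyer

end
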